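/-
Copyright (c) 2026 the pub-hodgecm-mathlib formalisation cell (harness21).  Prover seat hodgecm-mathlib-K2E1-p11 (g2), Track B ∕ K2-LIT, h413 =
`stmt-HodgeConjecture-24833`, line `K2_E1_TraceFormulaBeta`, 5Res campaign «ENDGAME BY FAMILIES» ∕ ROADCARD §3′ (M2 v2, amendment #2 (228)(i′)), ruling (244)(x1) FILE B2: the OPERATOR
FORM of the arch symbol action — `R(h)` preserves the closed span `Θ` of a `χ`-section pseudo-Eisenstein family of `U(1,1)_{L∕L⁺}` and `U R(h) = M_{s_h} U` there, for ★ K2E4-p10's Plancherel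
isometry `U` (off-dual model `L²(ℝ × K_U)`): the letters `hU`∕`hscalar` of D5′, from the generator relations ★ FILE B1 (`R(h)x_{(f,φ)} = x_{(g,φ)}`) and ★ FILE A (`u_{(g,φ)} = M_{s_h}u_{(f,φ)}`).
-/
import Summits.HodgeConjecture.HodgeConjecture.Theorems.K2E1ChiSectionHeckeStableCMTwo       -- ★ (x1) FILE B1 p860490 (this seat): `integratedOperator_eq_of_ae_eq_radialSection_cm_two`; brings ★ FILE A (`mellin_smoothingProfile_axis`), ★ D4′d (`symbol_eq_integral_of_mem_K`)
import Summits.HodgeConjecture.HodgeConjecture.Theorems.K2E1PlancherelIsometryOfForm            -- ★ P3a p859954 (K2E4-p23): `mem_topologicalClosure_span`, `linearCombination_mem_topologicalClosure`, `denseRange_codRestrict_linearCombination`, `linearIsometry_apply_linearCombination`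
import Mathlib.MeasureTheory.Function.Holder
import HarnessLib

/-!
# (x1) FILE B2 — `K2E1ChiSectionHeckeIntertwiningCMTwo`: `R(h)(Θ) ⊆ Θ` and `U R(h) = M_{s_h} U` on the closed span of a `χ`-section pseudo-Eisenstein family — the letters `hU`∕`hscalar`

Cell `pub/hodgecm-mathlib`, crux H413 = `stmt-HodgeConjecture-24833`, route `HCCMUnconditional`; dealer K2E1-plan (g7) ruling (244)(x1) («the OPERATOR FORM hU∕hscalar»), FILE A∕B plan «=».  THEOREMS
ONLY (no `def` ∕ `instance` ∕ `notation` ∕ named-fact hypothesis ∕ `sorry`; the multiplier `M_s = (s|_{axis}) • ·` is Mathlib's Hölder `Lp`-smul, packaged as a `→L[ℂ]` INSIDE the proof);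
lane `--kind proof --supports stmt-HodgeConjecture-24833 --as helper` (count-neutral; closes no socket).
THE MATHEMATICS ([MoeglinWaldspurger1995, II.2.4]; [ReedSimonI1980, Thm. I.7]; [BernsteinLapid2019, §4 Claim 1]).  (§0, Mathlib + ★ P3a) GENERATOR-WISE INTERTWINING EXTENDS TO THE CLOSED SPAN:
`x : ι → H`, `u : ι → M`, `U : closure span x →ₗᵢ M` with `U xᵢ = uᵢ`; if bounded `R`, `Mop` and `τ : ι → ι` satisfy `R xᵢ = x_{τ i}`, `Mop uᵢ = u_{τ i}`, then `R(E) ⊆ E` and `U(Rv) = Mop(Uv)` on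
`E` (finite combinations by linearity, density ★ `denseRange_codRestrict_linearCombination`, `DenseRange.equalizer`) — the lemma K2E4-p23's D4′b part 1 was to supply (never filed; dealer
13:1xZ «re-file it»).  (§1) THE SYMBOL IS BOUNDED ON THE UNITARY AXIS: from ★ D4′d `s(z) = ∫ h·Φ·H(k₀·)^z`, `‖s(½+iy)‖ ≤ ∫ ‖h‖·‖Φ‖·H(k₀·)^{½} =: B`, so `σ(y,k) := s(½+iy)` is in `L^∞(ℝ × K_U)`
and the multiplier `M_s g := σ • g` (Hölder `∞·2 → 2`) is a bounded operator; `M_s u_{(f,φ)} = u_{(g,φ)}` by ★ FILE A `mellin_smoothingProfile_axis`.  (§2) HEAD **`hU_offDual_cm_two`**: for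
★ K2E4-p10's data (`x_i =ᵐ quotFun θ_{f_i,φ_i}`, `u_i =ᵐ f̃_i(−(½+iy))φ_i(k)`, `U x_i = c•u_i`) indexed by a NON-EMPTY family CLOSED under the smoothing profile (`τ`, `φ_{τ i} = φ_i`, `f_{τ i} = g_i`), every
`φ_i` a continuous bounded `χ`-section with `φ_i(k₀ᵢ) ≠ 0`, `f_i ∈ C²_c((0,∞))`, and `h = η ∈ C_c(G(𝔸))` acting on all flat sections `f_z^{φ_i}` by ONE symbol `s` (★ P1): **`R(η)(Θ) ⊆ Θ`** and
**`U(R(η)v) = σ • U(v)` for all `v ∈ Θ`** — `hU`; `hscalar` is the same statement read on an irreducible.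
* §0 **`apply_mem_topologicalClosure_span_of_generators`**, **`linearIsometry_apply_eq_of_generators`**.  * §1 `re_half_add_mul_I`, **`norm_symbol_axis_le`**, **`memLp_top_symbolAxis`**,
  `lpSMul_smul_eq_of_ae_eq_axisModel`.  * §2 `generator_relations_offDual_cm_two`, **`hU_offDual_cm_two`**.
HONEST LABEL.  Count-neutral helper; proves no printed statement; letter-free except the binders it is fed (★ P1's `hact`, K2E4-p10's `hx∕hu∕hU`, the τ-closure of the index family).  The SELF-DUAL
edition (residue blocks scaled by `s(z_j)`, the `Lp W 2 (Ioi 0)` coordinate) is the same §0 argument on K2E4-p10's SD bytes — not typed here.  HC_CM is proved only modulo the 7 printed citations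
(2 remaining named inputs: hLiu418 = `stmt-HodgeConjecture-24832`, h413 = `stmt-HodgeConjecture-24833`) until rung 0 closes.

## References
* [MoeglinWaldspurger1995] C. Mœglin, J.-L. Waldspurger, *Spectral decomposition and Eisenstein series* (1995), II.2.4.
* [ReedSimonI1980] M. Reed, B. Simon, *Methods of Modern Mathematical Physics I* (1980), Thm. I.7 (BLT extension).
* [BernsteinLapid2019] J. Bernstein, E. Lapid, *On the meromorphic continuation of Eisenstein series*, J. AMS 37 (2024), §4 Claim 1.
-/

set_option autoImplicit false
-- the mandated namespace repeats `HodgeConjecture.HodgeConjecture`, as in every `Theorems/*.lean` of this sub-problem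
set_option linter.dupNamespace false

noncomputable section

open MeasureTheory MeasureTheory.Measure Set Filter Topology Complex NumberField CompactlySupported Submodule
open scoped NNReal ENNReal
open Literature.NumberTheory.Automorphic Literature.NumberTheory.Automorphic.UnitaryGroup AdelicGroupData ContRepresentation
open Literature.NumberTheory.GaloisRepresentations (HeckeCharacter)
open Summit.HodgeConjecture.HodgeConjecture.Cruxes.H413.K2E1BorelEisensteinU
open Summit.HodgeConjecture.HodgeConjecture.Cruxes.H413.K2E1CharacterEisensteinU2Defs
open Summit.HodgeConjecture.HodgeConjecture.Cruxes.H413.K2E1SphericalHeckeEigenSectionU2 (continuous_borelHeight_coe borelHeight_coe_pos)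
open Summit.HodgeConjecture.HodgeConjecture.Cruxes.H413.K2E1PlancherelIsometryOfForm (mem_topologicalClosure_span linearCombination_mem_topologicalClosure denseRange_codRestrict_linearCombination
  linearIsometry_apply_linearCombination)
open Summit.HodgeConjecture.HodgeConjecture.Cruxes.H413.K2E1ArchSphericalTypeSymbolActionU2 (symbol_eq_integral_of_mem_K)
open Summit.HodgeConjecture.HodgeConjecture.Cruxes.H413.K2E1ChiSectionSmoothingProfileU2 (mellin_smoothingProfile_axis)
open Summit.HodgeConjecture.HodgeConjecture.Cruxes.H413.K2E1ChiSectionHeckeStableCMTwo (integratedOperator_eq_of_ae_eq_radialSection_cm_two)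

namespace Summit.HodgeConjecture.HodgeConjecture.Cruxes.H413.K2E1ChiSectionHeckeIntertwiningCMTwo

/-! ## §0 Generator-wise intertwining extends to the closed span (Mathlib + ★ P3a) -/

section Abstract

variable {ι H M : Type*} [NormedAddCommGroup H] [InnerProductSpace ℂ H] [NormedAddCommGroup M] [InnerProductSpace ℂ M]

/-- **A BOUNDED OPERATOR PERMUTING THE GENERATORS PRESERVES THE CLOSED SPAN**: `R xᵢ = x_{τ i}` for all `i` ⟹ `R(E) ⊆ E`, `E = closure span x`. [cite: ReedSimonI1980, Thm. I.7] -/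
theorem apply_mem_topologicalClosure_span_of_generators (x : ι → H) (R : H →L[ℂ] H) (τ : ι → ι) (hR : ∀ i, R (x i) = x (τ i))
    {v : H} (hv : v ∈ (span ℂ (Set.range x)).topologicalClosure) : R v ∈ (span ℂ (Set.range x)).topologicalClosure := by
  have hspan : (span ℂ (Set.range x)).map (R : H →ₗ[ℂ] H) ≤ span ℂ (Set.range x) := by
    rw [Submodule.map_span_le]
    rintro _ ⟨i, rfl⟩
    rw [ContinuousLinearMap.coe_coe, hR i]
    exact subset_span (Set.mem_range_self _)
  have himg : R '' closure (span ℂ (Set.range x) : Set H) ⊆ closure (span ℂ (Set.range x) : Set H) :=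
    (image_closure_subset_closure_image R.continuous).trans (closure_mono (by
      rintro _ ⟨w, hw, rfl⟩
      exact hspan ⟨w, hw, rfl⟩))
  rw [← SetLike.mem_coe, topologicalClosure_coe] at hv ⊢
  exact himg ⟨v, hv, rfl⟩

/-- **GENERATOR-WISE INTERTWINING EXTENDS TO THE CLOSED SPAN**: `U` a linear isometry on `E = closure span x` with `U xᵢ = uᵢ`; bounded `R`, `Mop`, and `τ` with `R xᵢ = x_{τ i}`, `Mop uᵢ = u_{τ i}`
⟹ `U (R v) = Mop (U v)` for all `v ∈ E` (linearity on finite combinations — `LinearMap.map_finsupp_linearCombination`, `Finsupp.linearCombination_mapDomain`, ★ `linearIsometry_apply_linearCombination` —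
then density ★ `denseRange_codRestrict_linearCombination` + `DenseRange.equalizer`). [cite: ReedSimonI1980, Thm. I.7] [cite: MoeglinWaldspurger1995, II.2.4] -/
theorem linearIsometry_apply_eq_of_generators {x : ι → H} {u : ι → M} (U : (span ℂ (Set.range x)).topologicalClosure →ₗᵢ[ℂ] M)
    (hU : ∀ i, U ⟨x i, mem_topologicalClosure_span x i⟩ = u i) (R : H →L[ℂ] H) (Mop : M →L[ℂ] M) (τ : ι → ι)
    (hR : ∀ i, R (x i) = x (τ i)) (hM : ∀ i, Mop (u i) = u (τ i))
    {v : H} (hv : v ∈ (span ℂ (Set.range x)).topologicalClosure) :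
    U ⟨R v, apply_mem_topologicalClosure_span_of_generators x R τ hR hv⟩ = Mop (U ⟨v, hv⟩) := by
  set Φ₁ : (span ℂ (Set.range x)).topologicalClosure → M := fun w => U ⟨R (w : H), apply_mem_topologicalClosure_span_of_generators x R τ hR w.2⟩ with hΦ₁
  set Φ₂ : (span ℂ (Set.range x)).topologicalClosure → M := fun w => Mop (U w) with hΦ₂
  have hc₁ : Continuous Φ₁ := U.continuous.comp ((R.continuous.comp continuous_subtype_val).subtype_mk _)
  have hc₂ : Continuous Φ₂ := Mop.continuous.comp U.continuous
  have hRlc : ∀ l : ι →₀ ℂ, R (Finsupp.linearCombination ℂ x l) = Finsupp.linearCombination ℂ x (Finsupp.mapDomain τ l) := by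
    intro l
    have hcomp : (⇑(R : H →ₗ[ℂ] H)) ∘ x = x ∘ τ := funext fun i => hR i
    rw [← ContinuousLinearMap.coe_coe, LinearMap.map_finsupp_linearCombination, Finsupp.linearCombination_mapDomain, hcomp]
  have hMlc : ∀ l : ι →₀ ℂ, Mop (Finsupp.linearCombination ℂ u l) = Finsupp.linearCombination ℂ u (Finsupp.mapDomain τ l) := by
    intro l
    have hcomp : (⇑(Mop : M →ₗ[ℂ] M)) ∘ u = u ∘ τ := funext fun i => hM i
    rw [← ContinuousLinearMap.coe_coe, LinearMap.map_finsupp_linearCombination, Finsupp.linearCombination_mapDomain, hcomp]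
  have hagree : Φ₁ ∘ (LinearMap.codRestrict (span ℂ (Set.range x)).topologicalClosure (Finsupp.linearCombination ℂ x) (linearCombination_mem_topologicalClosure x)) =
      Φ₂ ∘ (LinearMap.codRestrict (span ℂ (Set.range x)).topologicalClosure (Finsupp.linearCombination ℂ x) (linearCombination_mem_topologicalClosure x)) := by
    funext l
    have h0 : LinearMap.codRestrict (span ℂ (Set.range x)).topologicalClosure (Finsupp.linearCombination ℂ x) (linearCombination_mem_topologicalClosure x) l =
        ⟨Finsupp.linearCombination ℂ x l, linearCombination_mem_topologicalClosure x l⟩ := rfl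
    have h1 : (⟨R (Finsupp.linearCombination ℂ x l), apply_mem_topologicalClosure_span_of_generators x R τ hR (linearCombination_mem_topologicalClosure x l)⟩ :
        (span ℂ (Set.range x)).topologicalClosure) = ⟨Finsupp.linearCombination ℂ x (Finsupp.mapDomain τ l), linearCombination_mem_topologicalClosure x _⟩ :=
      Subtype.ext (hRlc l)
    show U ⟨R (Finsupp.linearCombination ℂ x l), apply_mem_topologicalClosure_span_of_generators x R τ hR (linearCombination_mem_topologicalClosure x l)⟩ =
      Mop (U (LinearMap.codRestrict (span ℂ (Set.range x)).topologicalClosure (Finsupp.linearCombination ℂ x) (linearCombination_mem_topologicalClosure x) l))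
    rw [h1, h0, linearIsometry_apply_linearCombination U hU, linearIsometry_apply_linearCombination U hU, hMlc]
  have heq := (denseRange_codRestrict_linearCombination x).equalizer hc₁ hc₂ hagree
  exact congrFun heq ⟨v, hv⟩

end Abstract

/-! ## §1 The symbol is bounded on the unitary axis; the multiplier `M_s` -/

section Symbol

variable {F E : Type} [Field F] [NumberField F] [Field E] [NumberField E] [Algebra F E] {c : E ≃ₐ[F] E} {N : ℕ} [NeZero N]
variable [MeasurableSpace (quasiSplit F E c N).Adelic]

omit [MeasurableSpace (quasiSplit F E c N).Adelic] [NeZero N] in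
/-- `Re(½ + iy) = ½`. [folklore] -/
theorem re_half_add_mul_I (y : ℝ) : ((((1 / 2 : ℝ)) : ℂ) + y * I).re = 1 / 2 := by
  simp

/-- **THE SYMBOL IS BOUNDED ON THE UNITARY AXIS**: with ★ D4′d `s(z) = ∫ h·(φ(k₀·)∕φ(k₀))·H(k₀·)^z`, for every `y`
`‖s(½ + iy)‖ ≤ ∫ ‖h‖·(‖φ(k₀·)∕φ(k₀)‖·H(k₀·)^{½}) dν_G` (a constant). [cite: BernsteinLapid2019, §4 Claim 1] -/
theorem norm_symbol_axis_le (νG : Measure (quasiSplit F E c N).Adelic) {h φ : (quasiSplit F E c N).Adelic → ℂ} {k₀ : (quasiSplit F E c N).Adelic}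
    (hk₀ : adelicVal F E c N ((StdForm.antidiagonal N).over E) k₀ ∈ standardMaximalCompactGL N E) (hx₀ : φ k₀ ≠ 0) {s : ℂ → ℂ}
    (hact : ∀ z : ℂ, ∫ y, h y * flatSectionU φ z (k₀ * y) ∂νG = s z * flatSectionU φ z k₀) (y : ℝ) :
    ‖s ((((1 / 2 : ℝ)) : ℂ) + y * I)‖ ≤ ∫ w, ‖h w‖ * (‖φ (k₀ * w) / φ k₀‖ * ((borelHeight (k₀ * w) : ℝ≥0) : ℝ) ^ (1 / 2 : ℝ)) ∂νG := by
  rw [symbol_eq_integral_of_mem_K νG hk₀ hact hx₀]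
  refine (norm_integral_le_integral_norm _).trans (le_of_eq (integral_congr_ae (Eventually.of_forall fun w => ?_)))
  show ‖h w * ((φ (k₀ * w) / φ k₀) * ((((borelHeight (k₀ * w) : ℝ≥0) : ℝ) : ℂ) ^ ((((1 / 2 : ℝ)) : ℂ) + y * I)))‖ = _
  rw [norm_mul, norm_mul, norm_cpow_eq_rpow_re_of_pos (borelHeight_coe_pos (k₀ * w)), re_half_add_mul_I]

/-- **`σ(y,k) := s(½ + iy)` IS IN `L^∞(ℝ × K)`** for any finite product measure, `s` continuous (★ P1: entire) and bounded on the axis (previous lemma). [cite: BernsteinLapid2019, §4 Claim 1] -/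
theorem memLp_top_symbolAxis {X : Type*} [MeasurableSpace X] (m : Measure (ℝ × X)) {s : ℂ → ℂ} (hsc : Continuous s) {B : ℝ}
    (hB : ∀ y : ℝ, ‖s ((((1 / 2 : ℝ)) : ℂ) + y * I)‖ ≤ B) [TopologicalSpace X] [OpensMeasurableSpace (ℝ × X)] :
    MemLp (fun p : ℝ × X => s ((((1 / 2 : ℝ)) : ℂ) + p.1 * I)) ∞ m :=
  memLp_top_of_bound ((hsc.comp (continuous_const.add ((continuous_ofReal.comp continuous_fst).mul continuous_const))).aestronglyMeasurable) B
    (Eventually.of_forall fun p => hB p.1)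

end Symbol

/-! ## §2 HEAD: `R(η)(Θ) ⊆ Θ` and `U R(η) = M_s U` on the closed span of a `χ`-section pseudo-Eisenstein family of `U(1,1)_{L∕L⁺}` (off-dual model) -/

section Two

variable (L : Type) [Field L] [NumberField L] [IsCMField L]
variable [MeasurableSpace (quasiSplit (↥(maximalRealSubfield L)) L (IsCMField.complexConj L) 2).Adelic] [BorelSpace (quasiSplit (↥(maximalRealSubfield L)) L (IsCMField.complexConj L) 2).Adelic]

/-- On the off-dual model `L²(ℝ × K_U)`: if `u =ᵐ f̃(−(½+iy))·ψ(k)` and `u′ =ᵐ g̃(−(½+iy))·ψ(k)` with `g̃(−(½+iy)) = s(½+iy)·f̃(−(½+iy))` (★ FILE A), then `σ • (c • u) = c • u′` for `σ = s(½+i·)` in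
`L^∞` and any scalar `c` (a.e. computation: Mathlib `Lp.coeFn_lpSMul`, `Lp.coeFn_smul`). [cite: MoeglinWaldspurger1995, II.2.4] -/
theorem lpSMul_smul_eq_of_ae_eq_axisModel {X : Type*} [MeasurableSpace X] {m : Measure (ℝ × X)} [ENNReal.HolderTriple ∞ 2 2] {s : ℂ → ℂ}
    (hw : MemLp (fun p : ℝ × X => s ((((1 / 2 : ℝ)) : ℂ) + p.1 * I)) ∞ m) (c : ℂ) {f g : ℝ → ℂ} {ψ : X → ℂ}
    (hfg : ∀ y : ℝ, mellin g (-((((1 / 2 : ℝ)) : ℂ) + y * I)) = s ((((1 / 2 : ℝ)) : ℂ) + y * I) * mellin f (-((((1 / 2 : ℝ)) : ℂ) + y * I)))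
    (u u' : Lp ℂ 2 m) (hu : (u : ℝ × X → ℂ) =ᵐ[m] fun p => mellin f (-((((1 / 2 : ℝ)) : ℂ) + p.1 * I)) * ψ p.2)
    (hu' : (u' : ℝ × X → ℂ) =ᵐ[m] fun p => mellin g (-((((1 / 2 : ℝ)) : ℂ) + p.1 * I)) * ψ p.2) :
    (hw.toLp _ : Lp ℂ ∞ m) • (c • u) = c • u' := by
  refine Lp.ext_iff.2 ?_
  refine (Lp.coeFn_lpSMul (hw.toLp _) (c • u)).trans ?_
  filter_upwards [hw.coeFn_toLp, Lp.coeFn_smul c u, Lp.coeFn_smul c u', hu, hu'] with p hp hcu hcu' hpu hpu'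
  rw [Pi.smul_apply', hp, hcu, hcu', Pi.smul_apply, Pi.smul_apply, hpu, hpu', hfg, smul_eq_mul, smul_eq_mul, smul_eq_mul]
  ring

/-- **THE GENERATOR RELATIONS** behind `hU`: with the data of the HEAD below, the symbol `σ = s(½+i·)` is in `L^∞(ℝ × K_U)` and, for every index `i`,
`R(η) x_i = x_{τ i}` (★ FILE B1) and `σ • (c • u_i) = c • u_{τ i}` (★ FILE A on the axis). [cite: MoeglinWaldspurger1995, II.2.4] [cite: BernsteinLapid2019, §4 Claim 1] -/
theorem generator_relations_offDual_cm_two [ENNReal.HolderTriple ∞ 2 2]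
    [LocallyCompactSpace (quasiSplit (↥(maximalRealSubfield L)) L (IsCMField.complexConj L) 2).Adelic] [SecondCountableTopology (quasiSplit (↥(maximalRealSubfield L)) L (IsCMField.complexConj L) 2).Adelic]
    (μ : Measure (quasiSplit (↥(maximalRealSubfield L)) L (IsCMField.complexConj L) 2).automorphicQuotient) [(quasiSplit (↥(maximalRealSubfield L)) L (IsCMField.complexConj L) 2).IsAutomorphicMeasure μ]
    (νG : Measure (quasiSplit (↥(maximalRealSubfield L)) L (IsCMField.complexConj L) 2).Adelic) [νG.IsHaarMeasure] [SFinite νG]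
    (μK : Measure ((standardMaximalCompactGL 2 L).comap (adelicVal (↥(maximalRealSubfield L)) L (IsCMField.complexConj L) 2 ((StdForm.antidiagonal 2).over L)) : Subgroup (quasiSplit (↥(maximalRealSubfield L)) L (IsCMField.complexConj L) 2).Adelic))
    [IsFiniteMeasure μK]
    (η : C_c((quasiSplit (↥(maximalRealSubfield L)) L (IsCMField.complexConj L) 2).Adelic, ℂ)) {χ : HeckeCharacter L}
    {ι : Type*} [Nonempty ι] {f : ι → ℝ → ℂ} {φ : ι → (quasiSplit (↥(maximalRealSubfield L)) L (IsCMField.complexConj L) 2).Adelic → ℂ}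
    (hφ : ∀ i, IsChiSection χ (φ i)) (hφc : ∀ i, Continuous (φ i)) (Mφ : ι → ℝ) (hφM : ∀ i x, ‖φ i x‖ ≤ Mφ i)
    (k₀ : ι → (quasiSplit (↥(maximalRealSubfield L)) L (IsCMField.complexConj L) 2).Adelic) (hk₀ : ∀ i, adelicVal (↥(maximalRealSubfield L)) L (IsCMField.complexConj L) 2 ((StdForm.antidiagonal 2).over L) (k₀ i) ∈ standardMaximalCompactGL 2 L)
    (hx₀ : ∀ i, φ i (k₀ i) ≠ 0)
    (hf : ∀ i, ContDiff ℝ 2 (f i)) (hfs : ∀ i, HasCompactSupport (f i)) (hf0 : ∀ i, tsupport (f i) ⊆ Ioi 0)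
    {s : ℂ → ℂ} (hsc : Continuous s)
    (hact : ∀ (i : ι) (z : ℂ) (x : (quasiSplit (↥(maximalRealSubfield L)) L (IsCMField.complexConj L) 2).Adelic), ∫ y, η y * flatSectionU (φ i) z (x * y) ∂νG = s z * flatSectionU (φ i) z x)
    (x : ι → Lp ℂ 2 μ)
    (hx : ∀ i, (x i : (quasiSplit (↥(maximalRealSubfield L)) L (IsCMField.complexConj L) 2).automorphicQuotient → ℂ) =ᵐ[μ]
      (quasiSplit (↥(maximalRealSubfield L)) L (IsCMField.complexConj L) 2).quotFun (eisensteinSeriesU (fun g : (quasiSplit (↥(maximalRealSubfield L)) L (IsCMField.complexConj L) 2).Adelic => f i (borelHeight g : ℝ) * φ i g)))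
    (u : ι → Lp ℂ 2 ((volume : Measure ℝ).prod μK))
    (hu : ∀ i, (u i : ℝ × ((standardMaximalCompactGL 2 L).comap (adelicVal (↥(maximalRealSubfield L)) L (IsCMField.complexConj L) 2 ((StdForm.antidiagonal 2).over L)) : Subgroup (quasiSplit (↥(maximalRealSubfield L)) L (IsCMField.complexConj L) 2).Adelic) → ℂ)
      =ᵐ[(volume : Measure ℝ).prod μK] fun p => mellin (f i) (-((((1 / 2 : ℝ)) : ℂ) + p.1 * I)) * φ i (p.2 : (quasiSplit (↥(maximalRealSubfield L)) L (IsCMField.complexConj L) 2).Adelic))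
    -- the family is CLOSED under the smoothing profile: `x (τ i)`, `u (τ i)` represent `(g_i, φ_i)`, `g_i` the profile of ★ FILE A
    (τ : ι → ι)
    (hxτ : ∀ i, (x (τ i) : (quasiSplit (↥(maximalRealSubfield L)) L (IsCMField.complexConj L) 2).automorphicQuotient → ℂ) =ᵐ[μ]
      (quasiSplit (↥(maximalRealSubfield L)) L (IsCMField.complexConj L) 2).quotFun (eisensteinSeriesU (fun g : (quasiSplit (↥(maximalRealSubfield L)) L (IsCMField.complexConj L) 2).Adelic => (fun r : ℝ => ∫ w, f i (r * (borelHeight w : ℝ)) * (η ((k₀ i)⁻¹ * w) * (φ i w / φ i (k₀ i))) ∂νG) (borelHeight g : ℝ) * φ i g)))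
    (huτ : ∀ i, (u (τ i) : ℝ × ((standardMaximalCompactGL 2 L).comap (adelicVal (↥(maximalRealSubfield L)) L (IsCMField.complexConj L) 2 ((StdForm.antidiagonal 2).over L)) : Subgroup (quasiSplit (↥(maximalRealSubfield L)) L (IsCMField.complexConj L) 2).Adelic) → ℂ)
      =ᵐ[(volume : Measure ℝ).prod μK] fun p => mellin (fun r : ℝ => ∫ w, f i (r * (borelHeight w : ℝ)) * (η ((k₀ i)⁻¹ * w) * (φ i w / φ i (k₀ i))) ∂νG) (-((((1 / 2 : ℝ)) : ℂ) + p.1 * I)) * φ i (p.2 : (quasiSplit (↥(maximalRealSubfield L)) L (IsCMField.complexConj L) 2).Adelic))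
    (cU : ℂ) :
    ∃ hw : MemLp (fun p : ℝ × ((standardMaximalCompactGL 2 L).comap (adelicVal (↥(maximalRealSubfield L)) L (IsCMField.complexConj L) 2 ((StdForm.antidiagonal 2).over L)) : Subgroup (quasiSplit (↥(maximalRealSubfield L)) L (IsCMField.complexConj L) 2).Adelic) =>
        s ((((1 / 2 : ℝ)) : ℂ) + p.1 * I)) ∞ ((volume : Measure ℝ).prod μK),
      (∀ i, (((quasiSplit (↥(maximalRealSubfield L)) L (IsCMField.complexConj L) 2).rightRegular μ).integratedOperator ((quasiSplit (↥(maximalRealSubfield L)) L (IsCMField.complexConj L) 2).isUnitary_rightRegular μ) ((quasiSplit (↥(maximalRealSubfield L)) L (IsCMField.complexConj L) 2).isStronglyContinuous_rightRegular_holds μ) νG η) (x i) = x (τ i)) ∧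
      ∀ i, (hw.toLp _ : Lp ℂ ∞ ((volume : Measure ℝ).prod μK)) • (cU • u i) = cU • u (τ i) := by
  obtain ⟨i₀⟩ := ‹Nonempty ι›
  have hB := norm_symbol_axis_le νG (hk₀ i₀) (hx₀ i₀) (fun z => hact i₀ z (k₀ i₀))
  have hw : MemLp (fun p : ℝ × ((standardMaximalCompactGL 2 L).comap (adelicVal (↥(maximalRealSubfield L)) L (IsCMField.complexConj L) 2 ((StdForm.antidiagonal 2).over L)) : Subgroup (quasiSplit (↥(maximalRealSubfield L)) L (IsCMField.complexConj L) 2).Adelic) =>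
      s ((((1 / 2 : ℝ)) : ℂ) + p.1 * I)) ∞ ((volume : Measure ℝ).prod μK) := memLp_top_symbolAxis _ hsc hB
  refine ⟨hw, fun i => ?_, fun i => ?_⟩
  · exact integratedOperator_eq_of_ae_eq_radialSection_cm_two L μ νG η (hφ i) (hφc i) (hφM i) (hk₀ i) (hx₀ i) (hact i) (hf i) (hfs i) (hf0 i) (x i) (x (τ i)) (hx i) (hxτ i)
  · exact lpSMul_smul_eq_of_ae_eq_axisModel hw cU (f := f i) (ψ := fun k => φ i (k : (quasiSplit (↥(maximalRealSubfield L)) L (IsCMField.complexConj L) 2).Adelic))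
      (fun y => mellin_smoothingProfile_axis νG η.continuous η.hasCompactSupport (hφc i) (hk₀ i) (hx₀ i) (fun z => hact i z (k₀ i)) (hf i).continuous (hfs i) (hf0 i) y)
      (u i) (u (τ i)) (hu i) (huτ i)

/-- **HEAD — `hU`: `R(η)(Θ) ⊆ Θ` AND `U R(η) = M_s U` ON THE CLOSED SPAN `Θ` OF A `χ`-SECTION PSEUDO-EISENSTEIN FAMILY (off-dual model).**  Data of ★ K2E4-p10
`exists_linearIsometry_chiSection_offDual_cm_two`: `x_i =ᵐ quotFun θ_{f_i,φ_i}`, `u_i =ᵐ f̃_i(−(½+iy))·φ_i(k)`, a linear isometry `U` on `Θ = closure span x` with `U x_i = c • u_i`; the family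
is CLOSED under the smoothing profile of `η` (`τ`: `x_{τ i} =ᵐ quotFun θ_{g_i,φ_i}`, `u_{τ i} =ᵐ g̃_i(−(½+iy))·φ_i(k)`, `g_i` the explicit profile of ★ FILE A); each `φ_i` is a continuous bounded `χ`-section with `φ_i(k₀ᵢ) ≠ 0` (`k₀ᵢ ∈ K`), each `f_i ∈ C²_c((0,∞))`,
and `η ∈ C_c(G(𝔸))` acts on all flat sections `f_z^{φ_i}` by ONE continuous symbol `s` (★ P1 `exists_entire_symbol_of_arch`).  THEN: `R(η)v ∈ Θ` for `v ∈ Θ`, and with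
`σ(y,k) = s(½+iy) ∈ L^∞`: **`U(R(η)v) = σ • U(v)`** for every `v ∈ Θ`. [cite: MoeglinWaldspurger1995, II.2.4] [cite: BernsteinLapid2019, §4 Claim 1] [cite: ReedSimonI1980, Thm. I.7] -/
theorem hU_offDual_cm_two [ENNReal.HolderTriple ∞ 2 2]
    [LocallyCompactSpace (quasiSplit (↥(maximalRealSubfield L)) L (IsCMField.complexConj L) 2).Adelic] [SecondCountableTopology (quasiSplit (↥(maximalRealSubfield L)) L (IsCMField.complexConj L) 2).Adelic]
    (μ : Measure (quasiSplit (↥(maximalRealSubfield L)) L (IsCMField.complexConj L) 2).automorphicQuotient) [(quasiSplit (↥(maximalRealSubfield L)) L (IsCMField.complexConj L) 2).IsAutomorphicMeasure μ]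
    (νG : Measure (quasiSplit (↥(maximalRealSubfield L)) L (IsCMField.complexConj L) 2).Adelic) [νG.IsHaarMeasure] [SFinite νG]
    (μK : Measure ((standardMaximalCompactGL 2 L).comap (adelicVal (↥(maximalRealSubfield L)) L (IsCMField.complexConj L) 2 ((StdForm.antidiagonal 2).over L)) : Subgroup (quasiSplit (↥(maximalRealSubfield L)) L (IsCMField.complexConj L) 2).Adelic))
    [IsFiniteMeasure μK]
    (η : C_c((quasiSplit (↥(maximalRealSubfield L)) L (IsCMField.complexConj L) 2).Adelic, ℂ)) {χ : HeckeCharacter L}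
    {ι : Type*} [Nonempty ι] {f : ι → ℝ → ℂ} {φ : ι → (quasiSplit (↥(maximalRealSubfield L)) L (IsCMField.complexConj L) 2).Adelic → ℂ}
    (hφ : ∀ i, IsChiSection χ (φ i)) (hφc : ∀ i, Continuous (φ i)) (Mφ : ι → ℝ) (hφM : ∀ i x, ‖φ i x‖ ≤ Mφ i)
    (k₀ : ι → (quasiSplit (↥(maximalRealSubfield L)) L (IsCMField.complexConj L) 2).Adelic) (hk₀ : ∀ i, adelicVal (↥(maximalRealSubfield L)) L (IsCMField.complexConj L) 2 ((StdForm.antidiagonal 2).over L) (k₀ i) ∈ standardMaximalCompactGL 2 L)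
    (hx₀ : ∀ i, φ i (k₀ i) ≠ 0)
    (hf : ∀ i, ContDiff ℝ 2 (f i)) (hfs : ∀ i, HasCompactSupport (f i)) (hf0 : ∀ i, tsupport (f i) ⊆ Ioi 0)
    {s : ℂ → ℂ} (hsc : Continuous s)
    (hact : ∀ (i : ι) (z : ℂ) (x : (quasiSplit (↥(maximalRealSubfield L)) L (IsCMField.complexConj L) 2).Adelic), ∫ y, η y * flatSectionU (φ i) z (x * y) ∂νG = s z * flatSectionU (φ i) z x)
    (x : ι → Lp ℂ 2 μ)
    (hx : ∀ i, (x i : (quasiSplit (↥(maximalRealSubfield L)) L (IsCMField.complexConj L) 2).automorphicQuotient → ℂ) =ᵐ[μ]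
      (quasiSplit (↥(maximalRealSubfield L)) L (IsCMField.complexConj L) 2).quotFun (eisensteinSeriesU (fun g : (quasiSplit (↥(maximalRealSubfield L)) L (IsCMField.complexConj L) 2).Adelic => f i (borelHeight g : ℝ) * φ i g)))
    (u : ι → Lp ℂ 2 ((volume : Measure ℝ).prod μK))
    (hu : ∀ i, (u i : ℝ × ((standardMaximalCompactGL 2 L).comap (adelicVal (↥(maximalRealSubfield L)) L (IsCMField.complexConj L) 2 ((StdForm.antidiagonal 2).over L)) : Subgroup (quasiSplit (↥(maximalRealSubfield L)) L (IsCMField.complexConj L) 2).Adelic) → ℂ)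
      =ᵐ[(volume : Measure ℝ).prod μK] fun p => mellin (f i) (-((((1 / 2 : ℝ)) : ℂ) + p.1 * I)) * φ i (p.2 : (quasiSplit (↥(maximalRealSubfield L)) L (IsCMField.complexConj L) 2).Adelic))
    -- the family is CLOSED under the smoothing profile: `x (τ i)`, `u (τ i)` represent `(g_i, φ_i)`, `g_i` the profile of ★ FILE A
    (τ : ι → ι)
    (hxτ : ∀ i, (x (τ i) : (quasiSplit (↥(maximalRealSubfield L)) L (IsCMField.complexConj L) 2).automorphicQuotient → ℂ) =ᵐ[μ]
      (quasiSplit (↥(maximalRealSubfield L)) L (IsCMField.complexConj L) 2).quotFun (eisensteinSeriesU (fun g : (quasiSplit (↥(maximalRealSubfield L)) L (IsCMField.complexConj L) 2).Adelic => (fun r : ℝ => ∫ w, f i (r * (borelHeight w : ℝ)) * (η ((k₀ i)⁻¹ * w) * (φ i w / φ i (k₀ i))) ∂νG) (borelHeight g : ℝ) * φ i g)))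
    (huτ : ∀ i, (u (τ i) : ℝ × ((standardMaximalCompactGL 2 L).comap (adelicVal (↥(maximalRealSubfield L)) L (IsCMField.complexConj L) 2 ((StdForm.antidiagonal 2).over L)) : Subgroup (quasiSplit (↥(maximalRealSubfield L)) L (IsCMField.complexConj L) 2).Adelic) → ℂ)
      =ᵐ[(volume : Measure ℝ).prod μK] fun p => mellin (fun r : ℝ => ∫ w, f i (r * (borelHeight w : ℝ)) * (η ((k₀ i)⁻¹ * w) * (φ i w / φ i (k₀ i))) ∂νG) (-((((1 / 2 : ℝ)) : ℂ) + p.1 * I)) * φ i (p.2 : (quasiSplit (↥(maximalRealSubfield L)) L (IsCMField.complexConj L) 2).Adelic))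
    {cU : ℂ} (U : (span ℂ (Set.range x)).topologicalClosure →ₗᵢ[ℂ] Lp ℂ 2 ((volume : Measure ℝ).prod μK))
    (hU : ∀ i, U ⟨x i, mem_topologicalClosure_span x i⟩ = cU • u i) :
    ∃ hw : MemLp (fun p : ℝ × ((standardMaximalCompactGL 2 L).comap (adelicVal (↥(maximalRealSubfield L)) L (IsCMField.complexConj L) 2 ((StdForm.antidiagonal 2).over L)) : Subgroup (quasiSplit (↥(maximalRealSubfield L)) L (IsCMField.complexConj L) 2).Adelic) =>
        s ((((1 / 2 : ℝ)) : ℂ) + p.1 * I)) ∞ ((volume : Measure ℝ).prod μK),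
      ∀ (v : Lp ℂ 2 μ) (hv : v ∈ (span ℂ (Set.range x)).topologicalClosure),
        ∃ hRv : ((quasiSplit (↥(maximalRealSubfield L)) L (IsCMField.complexConj L) 2).rightRegular μ).integratedOperator ((quasiSplit (↥(maximalRealSubfield L)) L (IsCMField.complexConj L) 2).isUnitary_rightRegular μ) ((quasiSplit (↥(maximalRealSubfield L)) L (IsCMField.complexConj L) 2).isStronglyContinuous_rightRegular_holds μ) νG η v ∈
            (span ℂ (Set.range x)).topologicalClosure,
          U ⟨_, hRv⟩ = (hw.toLp _ : Lp ℂ ∞ ((volume : Measure ℝ).prod μK)) • U ⟨v, hv⟩ := by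
  obtain ⟨hw, hR', hM'⟩ := generator_relations_offDual_cm_two L μ νG μK η hφ hφc Mφ hφM k₀ hk₀ hx₀ hf hfs hf0 hsc hact x hx u hu τ hxτ huτ cU
  refine ⟨hw, fun v hv => ?_⟩
  -- the two operators as opaque bounded maps
  have hRex : ∃ R : Lp ℂ 2 μ →L[ℂ] Lp ℂ 2 μ, R = (((quasiSplit (↥(maximalRealSubfield L)) L (IsCMField.complexConj L) 2).rightRegular μ).integratedOperator ((quasiSplit (↥(maximalRealSubfield L)) L (IsCMField.complexConj L) 2).isUnitary_rightRegular μ) ((quasiSplit (↥(maximalRealSubfield L)) L (IsCMField.complexConj L) 2).isStronglyContinuous_rightRegular_holds μ) νG η) := ⟨_, rfl⟩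
  obtain ⟨R, hRdef⟩ := hRex
  have hwex : ∃ w : Lp ℂ ∞ ((volume : Measure ℝ).prod μK), w = hw.toLp _ := ⟨_, rfl⟩
  obtain ⟨w, hwdef⟩ := hwex
  have hMex : ∃ Mop : Lp ℂ 2 ((volume : Measure ℝ).prod μK) →L[ℂ] Lp ℂ 2 ((volume : Measure ℝ).prod μK), ∀ g, Mop g = w • g :=
    ⟨LinearMap.mkContinuous
      { toFun := fun g => w • g
        map_add' := fun g₁ g₂ => MeasureTheory.Lp.add_smul w g₁ g₂
        map_smul' := fun a g => (MeasureTheory.Lp.smul_comm a w g).symm }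
      ‖w‖ (fun g => MeasureTheory.Lp.norm_smul_le w g), fun g => rfl⟩
  obtain ⟨Mop, hMop⟩ := hMex
  have hR : ∀ i, R (x i) = x (τ i) := fun i => by rw [hRdef]; exact hR' i
  have hM : ∀ i, Mop (cU • u i) = cU • u (τ i) := fun i => by rw [hMop, hwdef]; exact hM' i
  have hmem := apply_mem_topologicalClosure_span_of_generators x R τ hR hv
  have key := linearIsometry_apply_eq_of_generators (u := fun i => cU • u i) U hU R Mop τ hR hM hv
  rw [hMop, hwdef] at key
  subst hRdef
  exact ⟨hmem, key⟩

end Two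

end Summit.HodgeConjecture.HodgeConjecture.Cruxes.H413.K2E1ChiSectionHeckeIntertwiningCMTwo

end
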